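import Mathlib
import Literature.Computability.AlgebraicComplexity.StandardFamilies

/-!
# Stub `stub_sliceRankOfBound` (crux `FreeSubtorus.OrbitDimensionBound`, line `Sketch`)

From the subspace bound to the slice rank of the permanent (rung `j = 1` of the product-rank
ladder).  Hypothesis `H`: every linear subspace `U` of `n × n` matrices (typed `Fin n → Fin n → ℂ`)
on which the permanent vanishes identically satisfies `finrank U + n ≤ n * n`.  Conclusion: every
decomposition `per_n = ∑_{t < w} ℓ_t * h_t` of the generic permanent with LINEAR forms `ℓ_t`
(homogeneous of degree `1`) has `n ≤ w`, i.e. the slice rank of `per_n` is `≥ n` (and Laplace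
expansion along one row shows it is `n`).  This is the permanent instance of
Gesmundo–Ghosal–Ikenmeyer–Lysikov, Prop. 9: "slice rank `≤ r` iff the zero set contains a linear
subspace of codimension `r`".

Proof.  A form `ℓ` of degree `1` evaluates linearly, `eval s ℓ = ∑_p coeff (single p 1) ℓ * s p`
(`eval_eq_sum_coeff_mul_of_isHomogeneous_one`), so `X ↦ eval (fun p => X p.1 p.2) (ℓ t)` is a
linear functional `L t` on matrices (`exists_linearMap_eq_eval_of_isHomogeneous_one`); bundle them into
`Φ : (Fin n → Fin n → ℂ) →ₗ[ℂ] (Fin w → ℂ)`.  On `U := ker Φ` the permanent vanishes (evaluate the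
decomposition at `X`: `eval_perPoly` on the left, `map_sum`/`map_mul` and `Φ X = 0` on the right),
so `H` gives `finrank (ker Φ) + n ≤ n * n`; rank–nullity (`LinearMap.finrank_range_add_finrank_ker`)
with `finrank (range Φ) ≤ w` and `finrank (Fin n → Fin n → ℂ) = n * n` gives `n ≤ w`.
-/

set_option linter.dupNamespace false

namespace Summit.ValiantsHypothesis.ValiantsHypothesis.Theorems.FreeSubtorusOrbitDimensionBound

open MvPolynomial Finset

/-- A linear form is the sum of its coefficients times the variables:
`f = ∑_p coeff (single p 1) f • X p` for `f` homogeneous of degree `1`. [folklore] -/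
theorem sum_coeff_single_smul_X_of_isHomogeneous_one {σ : Type*} [Fintype σ]
    {f : MvPolynomial σ ℂ} (hf : f.IsHomogeneous 1) :
    ∑ p, coeff (Finsupp.single p 1) f • (X p : MvPolynomial σ ℂ) = f := by
  -- adapted from Literature/AlgebraicGeometry/Motives/LinesGenerateChowOneProofs.lean
  classical
  ext d
  simp only [coeff_sum, coeff_smul, coeff_X, smul_eq_mul, mul_ite, mul_one, mul_zero]
  by_cases hd : ∃ p, Finsupp.single p 1 = d
  · obtain ⟨p, rfl⟩ := hd
    rw [Finset.sum_eq_single p (fun q _ hq => if_neg fun h =>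
      hq (Finsupp.single_left_injective one_ne_zero h)) (fun h => absurd (Finset.mem_univ p) h),
      if_pos rfl]
  · rw [Finset.sum_eq_zero fun p _ => if_neg fun h => hd ⟨p, h⟩]
    refine (hf.coeff_eq_zero fun hdeg => hd ?_).symm
    obtain ⟨p, hp⟩ := (Finsupp.sum_eq_one_iff d).mp hdeg
    exact ⟨p, hp.symm⟩

/-- Evaluation of a linear form is linear in the point:
`eval v f = ∑_p coeff (single p 1) f * v p` for `f` homogeneous of degree `1`. [folklore] -/
theorem eval_eq_sum_coeff_mul_of_isHomogeneous_one {σ : Type*} [Fintype σ]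
    {f : MvPolynomial σ ℂ} (hf : f.IsHomogeneous 1) (v : σ → ℂ) :
    eval v f = ∑ p, coeff (Finsupp.single p 1) f * v p := by
  -- adapted from Literature/AlgebraicGeometry/Motives/LinesGenerateChowOneProofs.lean
  conv_lhs => rw [← sum_coeff_single_smul_X_of_isHomogeneous_one hf]
  simp [map_sum, smul_eval, eval_X]

/-- A linear form `f` in the matrix entries `x_p`, `p : Fin n × Fin n`, is a linear functional of the
matrix `X` (rows `X i : Fin n → ℂ`): there is `L : (Fin n → Fin n → ℂ) →ₗ[ℂ] ℂ` with
`L X = eval (fun p => X p.1 p.2) f`, namely `L = ∑_p coeff (single p 1) f • (proj p.2 ∘ proj p.1)`.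
[folklore] -/
theorem exists_linearMap_eq_eval_of_isHomogeneous_one {n : ℕ} {f : MvPolynomial (Fin n × Fin n) ℂ}
    (hf : f.IsHomogeneous 1) :
    ∃ L : (Fin n → Fin n → ℂ) →ₗ[ℂ] ℂ, ∀ X, L X = eval (fun p : Fin n × Fin n => X p.1 p.2) f := by
  refine ⟨∑ p : Fin n × Fin n, coeff (Finsupp.single p 1) f •
    ((LinearMap.proj p.2 : (Fin n → ℂ) →ₗ[ℂ] ℂ).comp
      (LinearMap.proj p.1 : (Fin n → Fin n → ℂ) →ₗ[ℂ] (Fin n → ℂ))), fun X => ?_⟩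
  rw [eval_eq_sum_coeff_mul_of_isHomogeneous_one hf]
  simp [LinearMap.sum_apply]

/-- **Registered stub `stub_sliceRankOfBound`** (from the subspace bound to the slice rank).
If every subspace of `M_n(ℂ)` on which `per_n` vanishes has dimension `≤ n² - n`, then any
decomposition `per_n = Σ_{t<w} ℓ_t h_t` with LINEAR forms `ℓ_t` has `w ≥ n`: `per_n` vanishes on
the common kernel `⋂_t ker ℓ_t` (evaluate the identity, `eval_perPoly`), a subspace of dimension
`≥ n² - w` (rank–nullity for `X ↦ (ℓ_t(X))_t`).  Gesmundo–Ghosal–Ikenmeyer–Lysikov, Prop. 9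
(slice rank `≤ r` iff `Z(F)` contains a linear subspace of codimension `r`), for the permanent.
[cite: GesmundoGhosalIkenmeyerLysikov2022, Prop. 9] -/
theorem stub_sliceRankOfBound :
    ∀ (n : ℕ), (∀ U : Submodule ℂ (Fin n → Fin n → ℂ),
        (∀ X ∈ U, (Matrix.of X).permanent = 0) → Module.finrank ℂ U + n ≤ n * n) →
      ∀ (w : ℕ) (ℓ h : Fin w → MvPolynomial (Fin n × Fin n) ℂ),
        (∀ t, (ℓ t).IsHomogeneous 1) →
        Literature.Computability.AlgebraicComplexity.perPoly (Fin n) ℂ = ∑ t, ℓ t * h t → n ≤ w := by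
  intro n H w ℓ h hℓ hper
  -- each `ℓ t` as a linear functional `L t` of the matrix, bundled into `Φ : X ↦ (ℓ_t(X))_t`
  choose L hL using fun t => exists_linearMap_eq_eval_of_isHomogeneous_one (hℓ t)
  let Φ : (Fin n → Fin n → ℂ) →ₗ[ℂ] (Fin w → ℂ) := LinearMap.pi L
  -- (1) the permanent vanishes on `ker Φ = ⋂_t ker ℓ_t`
  have hker : ∀ X ∈ LinearMap.ker Φ, (Matrix.of X).permanent = 0 := by
    intro X hX
    have hX' : ∀ t, eval (fun p : Fin n × Fin n => X p.1 p.2) (ℓ t) = 0 := fun t => by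
      rw [← hL t X]
      exact congr_fun (LinearMap.mem_ker.mp hX) t
    have h₁ := congr_arg (eval fun p : Fin n × Fin n => X p.1 p.2) hper
    rw [Literature.Computability.AlgebraicComplexity.eval_perPoly, map_sum] at h₁
    rw [show (Matrix.of X) = Matrix.of fun i j : Fin n => X i j from rfl, h₁]
    exact Finset.sum_eq_zero fun t _ => by rw [map_mul, hX' t, zero_mul]
  -- (2) rank–nullity for `Φ`
  have h₁ := H _ hker
  have h₂ := LinearMap.finrank_range_add_finrank_ker Φ
  have h₃ : Module.finrank ℂ (LinearMap.range Φ) ≤ w :=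
    (Submodule.finrank_le _).trans (by simp)
  have h₄ : Module.finrank ℂ (Fin n → Fin n → ℂ) = n * n := by
    simp [Module.finrank_pi_fintype]
  omega

end Summit.ValiantsHypothesis.ValiantsHypothesis.Theorems.FreeSubtorusOrbitDimensionBound
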